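import Summits.QuantumFields.YangMills.Theorems.BalabanUVNodesN08AlphaMeasUk

/-!
# Route «BalabanUVNodes», Track-A DAG node N08 = [Balaban1985UV3] — THE (α) CLAUSE: for minimiser-selected external inputs the in-edge faces
# `measUk` AND `reg2` hold outright, so `InEdgeFaces₃` reduces to the ONE face `inB42`

Cell `pub-ymgap`, seat `pub-ymgap-dag-n08-d` gen 4, file 2 (director-ym R134 row «CLASS-I in-edge conclusions at the (α) granularity of `RunAlpha` …
discharge the species-OK interfaces `h68 ∕ hU ∕ h44 ∕ hLF67`»).  `bears_on: R4∕N08`; filed `--supports stmt-QuantumFields-19903 --as helper`.  Sorry-free,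
standard axioms.  Builds on this seat's files 1a `BalabanUVNodesN08AlphaGroupTopology` (the topology `rhoTopology 𝔊` of a group as printed) and 1b
`BalabanUVNodesN08AlphaMeasUk` (`exists_externalInputs_measUk`: external inputs whose `U_k(·, h)` are MEASURABLE selections of (42)-minimisers inside
prescribed OPEN regularity classes `O k h`, with the unit configuration as the value where the class holds no minimiser).

THE POINT.  The face `reg2` of `BalabanUVNodesN08AlphaLoop28.InEdgeFaces₃` says: `U_k(h, U)` satisfies [7]'s scale-`j` plaquette clauses (2)∕(8) over the
regions `Ω_j(h)`, `j < k`, at the constant `C68·g_jp(g_j)` — on the ℤ³ lift, `RegLift S j (Omega … k h j) (C68·g_jp(g_j)) (liftCfg 𝔊 (X.UkH k h U))`.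
§1–§2 show that this regularity class, read on torus configurations through the lift, is an OPEN set in the topology of the realisation (the lift's
plaquette holonomies are `ρ` of torus plaquette variables, `LiftBridge`-style, and `ℤ³ → T_η` is onto, so the class is a finite intersection of
strict inequalities on continuous functions) containing the unit configuration (`C68 > 0`, `g_j > 0`, `p(g_j) > 0`).  Taking it as the class `O k h`
of file 1b's selection, EVERY value of the selected `U_k(·, h)` lies in it (a minimiser in the class, or `1`): the face `reg2` holds for such
external inputs with no hypothesis, beside `measUk` (§3).  Hence (§3 `inEdgeFaces₃_of_inB42`) for them `InEdgeFaces₃ 𝔊 𝔠 X` — and with gen 2∕3's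
files the whole (α) in-edge schema — reduces to the ONE face `inB42` («Ū_k^j = V_j on Λ_j(h)» for an `h`-large field history: by clause (ii) of
file 1b it holds exactly where (42) HAS a minimiser in [7]'s class — the existence clause of [7] Thm 1 (8), the genuine in-edge b11 content).

HONEST FRAMING.  Kernel bookkeeping over the lane's own objects; [7] Thm 1 is NOT used or asserted; `inB42` stays displayed; nothing of [B10] is
asserted; count-neutral; NOT a discharge of N08.  d = 3 lattice gauge theory on finite tori as printed; nothing about d = 4, the continuum, OS
axioms, a mass gap or the Clay problem.
-/

noncomputable section

namespace Summit.QuantumFields.YangMills.Theorems.BalabanUVNodesN08AlphaRegSel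

open MeasureTheory Set Topology TopologicalSpace
open scoped Matrix Matrix.Norms.L2Operator
open Literature.MeasureTheory.RandomSets
open Literature.MathematicalPhysics.QuantumFieldTheory.Balaban1983to89
open Literature.MathematicalPhysics.QuantumFieldTheory.Balaban1983to89.B10 (pFun)
open Literature.MathematicalPhysics.QuantumFieldTheory.Balaban1985CMP102.Setting
open Summit.QuantumFields.Balaban3D.Carriers
open Summit.QuantumFields.Balaban3D.Proofs.Primitives (AlphaConsts)
open Summit.QuantumFields.Balaban3D.Proofs.GroupModelLieC (lieC)
open Summit.QuantumFields.Balaban3D.Proofs.LiftBridge (liftCfg)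
open Summit.QuantumFields.Balaban3D.Proofs.TorusLift (projSite projSite_add_e)
open Summit.QuantumFields.Balaban3D.Proofs.ScalesArithmetic (gk_pos gk_le_one)
open Summit.QuantumFields.YangMills.Theorems.BalabanUVNodesN08AlphaClassI (RegLift)
open Summit.QuantumFields.YangMills.Theorems.BalabanUVNodesN08AlphaLoop28 (InEdgeFaces₃)
open Summit.QuantumFields.YangMills.Theorems.BalabanUVNodesN08AlphaGroupTopology
open Summit.QuantumFields.YangMills.Theorems.BalabanUVNodesN08AlphaMeasUk
open B7Prop1Explicit (hol plaqWord e)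

variable {L : ℕ}

/-! ## §1 The lift's plaquette holonomies are `ρ` of torus plaquette variables -/

section Lift

variable {S : Scales L} {G : Type} [GaugeGroup G] [MeasurableSpace G] (𝔊 : GroupModel G)

/-- The torus plaquette variable at corner `y` in the (ordered) directions `μ, ν`: `U(y,μ) U(y+e_μ,ν) U(y+e_ν,μ)⁻¹ U(y,ν)⁻¹` (for `μ < ν` this is
`GaugeField.plaqHol U ⟨y, μ, ν, _⟩`; both orientations occur in [7] (2)). [cite: Balaban1985Averaging, (9) p.18] -/
def plaqVar (U : GaugeField S.P 0 G) (y : Site S.P 0) (μ ν : Fin S.P.d) : G :=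
  U ⟨y, μ⟩ * U ⟨y.shift μ, ν⟩ * (U ⟨y.shift ν, μ⟩)⁻¹ * (U ⟨y, ν⟩)⁻¹

/-- **The plaquette holonomy of the lift is `ρ` of the torus plaquette variable at the projected corner** (both orientations; cf.
`LiftBridge.val_hol_liftCfg` for `μ < ν`). [cite: Balaban1985Averaging, (9) p.18] -/
theorem val_hol_liftCfg_plaqWord (U : GaugeField S.P 0 G) (x : B7Prop1Explicit.Site S.P.d) (μ ν : Fin S.P.d) :
    ((hol (liftCfg 𝔊 U) x (plaqWord μ ν) : (Matrix (Fin 𝔊.N) (Fin 𝔊.N) ℂ)ˣ) : Matrix (Fin 𝔊.N) (Fin 𝔊.N) ℂ) =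
      𝔊.ρ (plaqVar U (projSite x) μ ν) := by
  rw [B7Prop1Local.hol_plaqWord_eq]
  simp only [liftCfg, projSite_add_e, ← map_inv, ← map_mul, MonoidHom.coe_toHomUnits, plaqVar]

/-- Hence `|(lift U)(∂p) − 1| = |U(∂p̄) − 1|` with the group's `|· − 1|` (`GroupModel.dist1_eq`). [cite: Balaban1985Variational, (2) p.278] -/
theorem norm_hol_liftCfg_sub_one (U : GaugeField S.P 0 G) (x : B7Prop1Explicit.Site S.P.d) (μ ν : Fin S.P.d) :
    ‖((hol (liftCfg 𝔊 U) x (plaqWord μ ν) : (Matrix (Fin 𝔊.N) (Fin 𝔊.N) ℂ)ˣ) : Matrix (Fin 𝔊.N) (Fin 𝔊.N) ℂ) - 1‖ =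
      dist1 (plaqVar U (projSite x) μ ν) := by
  rw [val_hol_liftCfg_plaqWord, 𝔊.dist1_eq]
  rfl

omit [MeasurableSpace G] in
/-- The projection `ηℤ³ → T_η` is onto (lift the residues). [folklore] -/
theorem projSite_surjective : Function.Surjective (projSite : B7Prop1Explicit.Site S.P.d → Site S.P 0) := by
  intro y
  refine ⟨fun κ => ((y κ).val : ℤ), ?_⟩
  funext κ
  simp [projSite]

/-- **[7] (2) on the lift, READ ON THE TORUS**: `RegLift S j Xs θ (liftCfg 𝔊 U)` iff every torus plaquette variable with a corner condition in `Xs`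
obeys `|U(∂p) − 1| < θL^{−2j}` (finitely many strict inequalities). [cite: Balaban1985Variational, (2) p.278] -/
theorem regLift_liftCfg_iff (j : ℕ) (Xs : Set (Site S.P 0)) (θ : ℝ) (U : GaugeField S.P 0 G) :
    RegLift S j Xs θ (liftCfg 𝔊 U) ↔ ∀ (y : Site S.P 0) (μ ν : Fin S.P.d), μ ≠ ν →
      (y ∈ Xs ∨ y.shift μ ∈ Xs ∨ y.shift ν ∈ Xs ∨ (y.shift μ).shift ν ∈ Xs) →
        dist1 (plaqVar U y μ ν) < θ * (((L : ℝ) ^ j)⁻¹) ^ 2 := by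
  constructor
  · intro h y μ ν hμν hcor
    obtain ⟨x, rfl⟩ := projSite_surjective (S := S) y
    rw [← norm_hol_liftCfg_sub_one]
    refine h x μ ν hμν ?_
    simpa only [projSite_add_e] using hcor
  · intro h x μ ν hμν hcor
    rw [norm_hol_liftCfg_sub_one]
    refine h (projSite x) μ ν hμν ?_
    simpa only [projSite_add_e] using hcor

end Lift

/-! ## §2 The regularity class of [7] (2) is open in the topology of the realisation and contains the unit configuration -/

section RegClass

variable {S : Scales L} {G : Type} [GaugeGroup G] [MeasurableSpace G] (𝔊 : GroupModel G)

/-- Torus plaquette variables are continuous in the topology of the realisation. [folklore] -/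
theorem continuous_plaqVar (y : Site S.P 0) (μ ν : Fin S.P.d) :
    letI := rhoTopology 𝔊; Continuous fun U : GaugeField S.P 0 G => plaqVar U y μ ν := by
  letI := rhoTopology 𝔊
  haveI := continuousMul_rho 𝔊
  haveI := continuousInv_rho 𝔊
  have hb : ∀ b : PBond S.P 0, Continuous fun U : GaugeField S.P 0 G => U b := fun b => continuous_apply b
  unfold plaqVar
  exact (((hb _).mul (hb _)).mul (hb _).inv).mul (hb _).inv

/-- **THE CLASS `{U | RegLift S j Xs θ (lift U)}` OF [7] (2) IS OPEN** in the topology of the realisation (finitely many strict inequalities on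
continuous functions of `U`, by `regLift_liftCfg_iff`). [cite: Balaban1985Variational, (2) p.278] -/
theorem isOpen_regLift (j : ℕ) (Xs : Set (Site S.P 0)) (θ : ℝ) :
    letI := rhoTopology 𝔊; IsOpen {U : GaugeField S.P 0 G | RegLift S j Xs θ (liftCfg 𝔊 U)} := by
  letI := rhoTopology 𝔊
  have hset : {U : GaugeField S.P 0 G | RegLift S j Xs θ (liftCfg 𝔊 U)} =
      ⋂ (y : Site S.P 0), ⋂ (μ : Fin S.P.d), ⋂ (ν : Fin S.P.d),
        {U | μ ≠ ν → (y ∈ Xs ∨ y.shift μ ∈ Xs ∨ y.shift ν ∈ Xs ∨ (y.shift μ).shift ν ∈ Xs) →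
          dist1 (plaqVar U y μ ν) < θ * (((L : ℝ) ^ j)⁻¹) ^ 2} := by
    ext U
    simp only [mem_setOf_eq, regLift_liftCfg_iff, mem_iInter]
  rw [hset]
  refine isOpen_iInter_of_finite fun y => isOpen_iInter_of_finite fun μ => isOpen_iInter_of_finite fun ν => ?_
  by_cases hμν : μ ≠ ν
  · by_cases hcor : (y ∈ Xs ∨ y.shift μ ∈ Xs ∨ y.shift ν ∈ Xs ∨ (y.shift μ).shift ν ∈ Xs)
    · have h2 : {U : GaugeField S.P 0 G | μ ≠ ν → (y ∈ Xs ∨ y.shift μ ∈ Xs ∨ y.shift ν ∈ Xs ∨ (y.shift μ).shift ν ∈ Xs) →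
          dist1 (plaqVar U y μ ν) < θ * (((L : ℝ) ^ j)⁻¹) ^ 2} = {U | dist1 (plaqVar U y μ ν) < θ * (((L : ℝ) ^ j)⁻¹) ^ 2} := by
        ext U
        simp only [mem_setOf_eq]
        exact ⟨fun h => h hμν hcor, fun h _ _ => h⟩
      rw [h2]
      exact isOpen_lt ((continuous_dist1_rho 𝔊).comp (continuous_plaqVar 𝔊 y μ ν)) continuous_const
    · have h2 : {U : GaugeField S.P 0 G | μ ≠ ν → (y ∈ Xs ∨ y.shift μ ∈ Xs ∨ y.shift ν ∈ Xs ∨ (y.shift μ).shift ν ∈ Xs) →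
          dist1 (plaqVar U y μ ν) < θ * (((L : ℝ) ^ j)⁻¹) ^ 2} = Set.univ := by
        ext U
        simp only [mem_setOf_eq, mem_univ, iff_true]
        exact fun _ h => absurd h hcor
      rw [h2]
      exact isOpen_univ
  · have h2 : {U : GaugeField S.P 0 G | μ ≠ ν → (y ∈ Xs ∨ y.shift μ ∈ Xs ∨ y.shift ν ∈ Xs ∨ (y.shift μ).shift ν ∈ Xs) →
        dist1 (plaqVar U y μ ν) < θ * (((L : ℝ) ^ j)⁻¹) ^ 2} = Set.univ := by
      ext U
      simp only [mem_setOf_eq, mem_univ, iff_true]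
      exact fun h => absurd h hμν
    rw [h2]
    exact isOpen_univ

omit [MeasurableSpace G] in
/-- The plaquette variables of the unit configuration are `1`. [folklore] -/
theorem plaqVar_one (y : Site S.P 0) (μ ν : Fin S.P.d) : plaqVar (1 : GaugeField S.P 0 G) y μ ν = 1 := by
  show (1 : G) * 1 * (1 : G)⁻¹ * (1 : G)⁻¹ = 1
  simp

/-- **The unit configuration is regular** for every positive constant: `RegLift S j Xs θ (lift 1)` when `0 < θ` (as `|1 − 1| = 0`). [cite: Balaban1985Variational, (2) p.278] -/
theorem regLift_liftCfg_one (j : ℕ) (Xs : Set (Site S.P 0)) {θ : ℝ} (hθ : 0 < θ) (hL : 0 < L) :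
    RegLift S j Xs θ (liftCfg 𝔊 (1 : GaugeField S.P 0 G)) := by
  rw [regLift_liftCfg_iff]
  intro y μ ν _ _
  rw [plaqVar_one, GaugeGroup.dist1_one]
  have hLj : 0 < (((L : ℝ) ^ j)⁻¹) ^ 2 := by positivity
  exact mul_pos hθ hLj

variable (𝔠 : AlphaConsts L 𝔊.N)

/-- **THE REGULARITY CLASS OF A HISTORY AT STEP `k`** — the set the face `reg2` asks `U_k(h, U)` to lie in: [7]'s (2)∕(8) over the regions `Ω_j(h)`,
`j < k`, at the constants `C68·g_jp(g_j)`, read on torus configurations through the lift. [cite: Balaban1985Variational, (2)+(8) pp.278–279; Balaban1985UV3, (68) p.273] -/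
def regClass (k : ℕ) (h : Hist S.P k) : Set (GaugeField S.P 0 G) :=
  {U | ∀ j < k, RegLift S j (Omega 𝔠.lane.carrier.M₁ (rcolOf S 𝔠.lane.carrier) k h j)
    (𝔠.C68 * (S.gk j * pFun 𝔠.lane.carrier.b₀ 𝔠.lane.carrier.p₀ (S.gk j))) (liftCfg 𝔊 U)}

/-- The regularity class of a history is OPEN in the topology of the realisation (finite intersection of §2's open classes). [cite: Balaban1985Variational, (2) p.278] -/
theorem isOpen_regClass (k : ℕ) (h : Hist S.P k) : letI := rhoTopology 𝔊; IsOpen (regClass 𝔊 𝔠 k h) := by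
  letI := rhoTopology 𝔊
  have hset : regClass 𝔊 𝔠 k h = ⋂ j ∈ Finset.range k, {U : GaugeField S.P 0 G |
      RegLift S j (Omega 𝔠.lane.carrier.M₁ (rcolOf S 𝔠.lane.carrier) k h j)
        (𝔠.C68 * (S.gk j * pFun 𝔠.lane.carrier.b₀ 𝔠.lane.carrier.p₀ (S.gk j))) (liftCfg 𝔊 U)} := by
    ext U
    simp only [regClass, mem_setOf_eq, mem_iInter, Finset.mem_range]
  rw [hset]
  exact isOpen_biInter_finset fun j _ => isOpen_regLift 𝔊 j _ _

/-- The unit configuration lies in every regularity class whose scales are `≤ K` (`C68 > 0`, `g_j > 0`, `p(g_j) > 0` as `g_j ≤ 1`). [cite: Balaban1985Variational, (2) p.278] -/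
theorem one_mem_regClass (k : ℕ) (hk : k ≤ S.K) (h : Hist S.P k) : (1 : GaugeField S.P 0 G) ∈ regClass 𝔊 𝔠 k h := by
  intro j hj
  have hg0 : 0 < S.gk j := gk_pos S j
  have hg1 : S.gk j ≤ 1 := gk_le_one S S.gK_le_one j (by omega)
  have hp : 0 < pFun 𝔠.lane.carrier.b₀ 𝔠.lane.carrier.p₀ (S.gk j) :=
    Summit.QuantumFields.Balaban3D.Proofs.CouplingWindow.pFun_pos _ _ _ (show 0 < 𝔠.b₀ from 𝔠.b₀_pos) hg0 hg1
  have hθ : 0 < 𝔠.C68 * (S.gk j * pFun 𝔠.lane.carrier.b₀ 𝔠.lane.carrier.p₀ (S.gk j)) := mul_pos 𝔠.C68_pos (mul_pos hg0 hp)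
  exact regLift_liftCfg_one 𝔊 j _ hθ (by have := 𝔠.one_lt_L; omega)

end RegClass

/-! ## §3 Minimiser-selected external inputs: `measUk` and `reg2` outright; `InEdgeFaces₃` from `inB42` alone -/

section Faces

variable {S : Scales L} {G : Type} [GaugeGroup G] [MeasurableSpace G] [HaarData G] (𝔊 : GroupModel G) (𝔠 : AlphaConsts L 𝔊.N)

/-- **★ EXTERNAL INPUTS WHOSE `U_k(·, h)` ARE MEASURABLE (42)-MINIMISER SELECTIONS INSIDE [7]'S REGULARITY CLASSES satisfy the faces `measUk`
AND `reg2` OUTRIGHT.**  For external inputs `X₀` with σ-closed-continuous averaging maps (e.g. the lane's standard family), a continuous objective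
`A` (e.g. `A^η`), constraint bonds `B k h` and measurable data embeddings `ι k h`: there are external inputs `X` with the same `av`, `reg` such that
(i) every `X.UkH k h` is measurable; (ii) for every `k ≤ K`, history `h` and field `U`, `U_k(h, U)` satisfies the scale-`j` plaquette clauses of
[7] (2)∕(8) over `Ω_j(h)`, `j < k`, at `C68·g_jp(g_j)` — the field `reg2` of `InEdgeFaces₃ 𝔊 𝔠 X` verbatim (indeed with no admissibility
proviso); (iii) at every non-trivial history `X.UkH k h V` minimises `A` on the (42)-constraint space inside the class whenever a minimiser exists
there, and (iv) so does `X.Uk k` for the trivial history at level `k + 1`.  (Values: a minimiser in the class, else `1`, which is in the class.)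
[cite: Balaban1985UV3, (42) p.266 + (68) p.273; Balaban1985Variational, (2)+(3)+(8) pp.278–279 (measurable-selection reading; Thm 1 NOT used)] -/
theorem exists_externalInputs_measUk_reg2 (X₀ : ExternalInputs S G)
    (hav : letI := rhoTopology 𝔊; ∀ j, SigmaClosedContinuous (X₀.av j).avg)
    {A : GaugeField S.P 0 G → ℝ} (hA : letI := rhoTopology 𝔊; Continuous A)
    (B : (k : ℕ) → Hist S.P k → (j : ℕ) → Set (PBond S.P j))
    (ι : (k : ℕ) → Hist S.P k → GaugeField S.P k G → ((j : Fin (k + 1)) → GaugeField S.P j G))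
    (hι : ∀ k h, Measurable (ι k h)) :
    ∃ X : ExternalInputs S G, X.av = X₀.av ∧ X.reg = X₀.reg ∧
      (∀ (k : ℕ) (h : Hist S.P k), Measurable (X.UkH k h)) ∧
      (∀ k, k ≤ S.K → ∀ (h : Hist S.P k) (U : GaugeField S.P k G), ∀ j < k,
        RegLift S j (Omega 𝔠.lane.carrier.M₁ (rcolOf S 𝔠.lane.carrier) k h j)
          (𝔠.C68 * (S.gk j * pFun 𝔠.lane.carrier.b₀ 𝔠.lane.carrier.p₀ (S.gk j))) (liftCfg 𝔊 (X.UkH k h U))) ∧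
      (∀ (k : ℕ) (h : Hist S.P k) (V : GaugeField S.P k G), h ≠ Hist.triv S.P k →
        (∃ U ∈ fibre42 X₀.av k (B k h) (regClass 𝔊 𝔠 k h) (ι k h V), IsMinOn A (fibre42 X₀.av k (B k h) (regClass 𝔊 𝔠 k h) (ι k h V)) U) →
          X.UkH k h V ∈ fibre42 X₀.av k (B k h) (regClass 𝔊 𝔠 k h) (ι k h V) ∧
            IsMinOn A (fibre42 X₀.av k (B k h) (regClass 𝔊 𝔠 k h) (ι k h V)) (X.UkH k h V)) ∧
      (∀ (k : ℕ) (V : GaugeField S.P (k + 1) G),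
        (∃ U ∈ fibre42 X₀.av (k + 1) (B (k + 1) (Hist.triv S.P (k + 1))) (regClass 𝔊 𝔠 (k + 1) (Hist.triv S.P (k + 1)))
            (ι (k + 1) (Hist.triv S.P (k + 1)) V),
          IsMinOn A (fibre42 X₀.av (k + 1) (B (k + 1) (Hist.triv S.P (k + 1))) (regClass 𝔊 𝔠 (k + 1) (Hist.triv S.P (k + 1)))
            (ι (k + 1) (Hist.triv S.P (k + 1)) V)) U) →
          X.Uk k V ∈ fibre42 X₀.av (k + 1) (B (k + 1) (Hist.triv S.P (k + 1))) (regClass 𝔊 𝔠 (k + 1) (Hist.triv S.P (k + 1)))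
              (ι (k + 1) (Hist.triv S.P (k + 1)) V) ∧
            IsMinOn A (fibre42 X₀.av (k + 1) (B (k + 1) (Hist.triv S.P (k + 1))) (regClass 𝔊 𝔠 (k + 1) (Hist.triv S.P (k + 1)))
              (ι (k + 1) (Hist.triv S.P (k + 1)) V)) (X.Uk k V)) := by
  obtain ⟨X, hav', hreg, hm, hmin, hminT, hout, houtT⟩ :=
    exists_externalInputs_measUk 𝔊 X₀ hav hA (regClass 𝔊 𝔠) (fun k h => isOpen_regClass 𝔊 𝔠 k h) B ι hι
  refine ⟨X, hav', hreg, hm, ?_, hmin, hminT⟩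
  intro k hk h U j hj
  -- the value `X.UkH k h U` lies in the class `regClass 𝔊 𝔠 k h`: a minimiser in the class, or `1`
  have hval : X.UkH k h U ∈ regClass 𝔊 𝔠 k h := by
    by_cases hh : h = Hist.triv S.P k
    · subst hh
      rw [X.UkH_triv]
      cases k with
      | zero => exact fun j hj => absurd hj (Nat.not_lt_zero j)
      | succ k =>
        show X.Uk k U ∈ regClass 𝔊 𝔠 (k + 1) (Hist.triv S.P (k + 1))
        by_cases hex : ∃ U' ∈ fibre42 X₀.av (k + 1) (B (k + 1) (Hist.triv S.P (k + 1)))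
            (regClass 𝔊 𝔠 (k + 1) (Hist.triv S.P (k + 1))) (ι (k + 1) (Hist.triv S.P (k + 1)) U),
            IsMinOn A (fibre42 X₀.av (k + 1) (B (k + 1) (Hist.triv S.P (k + 1))) (regClass 𝔊 𝔠 (k + 1) (Hist.triv S.P (k + 1)))
              (ι (k + 1) (Hist.triv S.P (k + 1)) U)) U'
        · exact ((mem_fibre42_iff.mp (hminT k U hex).1).1)
        · rw [houtT k U hex]
          exact one_mem_regClass 𝔊 𝔠 (k + 1) hk _
    · by_cases hex : ∃ U' ∈ fibre42 X₀.av k (B k h) (regClass 𝔊 𝔠 k h) (ι k h U),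
          IsMinOn A (fibre42 X₀.av k (B k h) (regClass 𝔊 𝔠 k h) (ι k h U)) U'
      · exact ((mem_fibre42_iff.mp (hmin k h U hh hex).1).1)
      · rw [hout k h U hh hex]
        exact one_mem_regClass 𝔊 𝔠 k hk h
  exact hval j hj

/-- **FOR SUCH EXTERNAL INPUTS `InEdgeFaces₃` IS THE ONE FACE `inB42`.**  If `X` satisfies `measUk` for all `k, h` and `reg2` for all `k ≤ K` (as the
external inputs of `exists_externalInputs_measUk_reg2` do), then the three-face schema `InEdgeFaces₃ 𝔊 𝔠 X` of gen 2∕3 — from which, with the DATA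
schema, `RunAlpha` and N08 at the record follow (`BalabanUVNodesN08AlphaThreeFaces.runAlpha_of_data_faces₃_of_le`,
`….b10_main_at_record_of_faces₃Pin`) — holds as soon as the constraint face `inB42` does. [cite: Balaban1985UV3, (42) p.266 + (67)–(68) p.273; Balaban1985Variational, (3)+(8) pp.278–279] -/
theorem inEdgeFaces₃_of_inB42 (X : ExternalInputs S G) (hm : ∀ (k : ℕ) (h : Hist S.P k), Measurable (X.UkH k h))
    (hreg : ∀ k, k ≤ S.K → ∀ (h : Hist S.P k) (U : GaugeField S.P k G), ∀ j < k,
      RegLift S j (Omega 𝔠.lane.carrier.M₁ (rcolOf S 𝔠.lane.carrier) k h j)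
        (𝔠.C68 * (S.gk j * pFun 𝔠.lane.carrier.b₀ 𝔠.lane.carrier.p₀ (S.gk j))) (liftCfg 𝔊 (X.UkH k h U)))
    (h42 : ∀ k, k ≤ S.K → ∀ (h : Hist S.P k), Hist.Admissible 𝔠.lane.carrier.M₁ (rcolOf S 𝔠.lane.carrier) k h →
      ∀ (U : GaugeField S.P k G), ∃ V : ℕ → B7Prop1Explicit.Site S.P.d → Fin S.P.d → (Matrix (Fin 𝔊.N) (Fin 𝔊.N) ℂ)ˣ,
        BalabanUVNodesN08AlphaClassI.HLarge S 𝔠.lane.carrier.b₀ 𝔠.lane.carrier.p₀ h V ∧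
          BalabanUVNodesN08AlphaClassI.InB42Lift S 𝔠.lane.carrier.M₁ (rcolOf S 𝔠.lane.carrier) h (liftCfg 𝔊 (X.UkH k h U)) V) :
    InEdgeFaces₃ 𝔊 𝔠 X where
  measUk := fun k _ h => hm k h
  inB42 := h42
  reg2 := fun k hk h _ U j hj => hreg k hk h U j hj

end Faces

end Summit.QuantumFields.YangMills.Theorems.BalabanUVNodesN08AlphaRegSel

end
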